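import Summits.QuantumFields.YangMills.Theorems.ToronSmallBallOwnAxisShiftGood
import Summits.QuantumFields.YangMills.Theorems.QuantileBitPurityGAxisQuat
import HarnessLib

/-!
# Ladders in every direction and the transport of the seam field along a line

Support module (`--supports` stmt-QuantumFields-23948, `QuantileBitPurity.HolonomyQuantileSubQuartic`; seat ym-dw-p1 g16, plan HOME
`bc/g15-dw/PLAN-CORE-GAXIS.md`, module S1).  On one slice `U` of the spatial torus `(ℤ/L)³` with `SU(2)` links (`q = su2Quat`), under a uniform
plaquette bound `‖q(U_p) − 1‖ ≤ ε`:

* §1 the transverse LADDER lemmas of `ToronSmallBallOwnAxisShiftLadder` in an ARBITRARY line direction `k` and transverse direction `j`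
  (`norm_su2Quat_transportDir_sub_le`: transporting the open line of `n` steps costs the `n` plaquettes in between; closed version; column version:
  carrying the closed `k`-line `m` steps along `e_j` by conjugation with the column holonomy costs `m · L · ε`);
* §2 the TIME ladder in direction `k` (`‖q(P^U) − q(P^V)‖ ≤ n τ` for linkwise `τ`-close `U, V`) and the TRANSPORT OF THE SEAM FIELD: if `g · U` is
  linkwise `τ`-close to `U` then `g` is covariantly constant up to `n τ` along any line of `n` steps
  (`norm_su2Quat_seamField_transport_sub_le`: `‖q(g(y + n e_k)) − q(P⁻¹ g(y) P)‖ ≤ n τ`, `P = lineHolonomy U k n y`);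
(The comb-transported plane links are treated in the companion module `QuantileBitPurityGAxisComb`.)

HONEST FRAMING: fixed-lattice bookkeeping; nothing about infinite volume, the continuum limit or the Clay gap.  No `sorry`, no new axiom, no new
definition.  References: [cite: Luscher1983, §2]; [cite: Wilson1974].
-/

set_option autoImplicit false

noncomputable section

open scoped Quaternion BigOperators
open NormedSpace Function
open Literature.MathematicalPhysics.QuantumLattice (su2Quat su2Quat_ne_zero norm_su2Quat)
open Literature.MathematicalPhysics.QuantumFieldTheory hiding su2Quat_mul
open Literature.MathematicalPhysics.QuantumFieldTheory.Balaban1983to89.T4HaarSU2Translate (su2Quat_mul su2Quat_one)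

namespace Summit.QuantumFields.YangMills.Theorems.FemtoTransferGap.GAxis

open ClassShift OwnAxis

variable {L : ℕ}

/-! ## §1 Transverse ladders in an arbitrary direction -/

/-- The plaquette relation in the plane `(k, j)`: `U(x,j) U(x+e_j,k) = U_{x;k,j}⁻¹ U(x,k) U(x+e_k,j)`. [folklore] -/
theorem transverse_step_dir_eq {G : Type*} [Group G] (U : GaugeConfig 3 L G) (x : Site 3 L) (k j : Fin 3) :
    U (x, j) * U (x.shift j, k) = (plaquetteHolonomy U x k j)⁻¹ * U (x, k) * U (x.shift k, j) := by
  unfold plaquetteHolonomy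
  group

/-- ★ **Transverse ladder in direction `k`**: transporting the open `k`-line of `n` steps from `x + e_j` back to `x` costs the plaquettes in between:
`‖q(U(x,j) · P_n(x+e_j) · U(x+ne_k,j)⁻¹) − q(P_n(x))‖ ≤ Σ_{m<n} ‖q(U_{x+me_k;k,j}) − 1‖`. [cite: Luscher1983, §2] -/
theorem norm_su2Quat_transportDir_sub_le (U : GaugeConfig 3 L SU2) (k j : Fin 3) (n : ℕ) :
    ∀ x : Site 3 L,
      ‖su2Quat (U (x, j) * lineHolonomy U k n (x.shift j) * (U ((fun y : Site 3 L => y.shift k)^[n] x, j))⁻¹) - su2Quat (lineHolonomy U k n x)‖ ≤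
        ∑ m ∈ Finset.range n, ‖su2Quat (plaquetteHolonomy U ((fun y : Site 3 L => y.shift k)^[m] x) k j) - 1‖ := by
  induction n with
  | zero => intro x; simp [lineHolonomy, su2Quat_one]
  | succ n ih =>
    intro x
    rw [Finset.sum_range_succ', Function.iterate_zero_apply]
    simp only [Function.iterate_succ_apply]
    have hstep : U (x, j) * lineHolonomy U k (n + 1) (x.shift j) * (U ((fun y : Site 3 L => y.shift k)^[n] (x.shift k), j))⁻¹ =
        (plaquetteHolonomy U x k j)⁻¹ * U (x, k) *
          (U (x.shift k, j) * lineHolonomy U k n ((x.shift k).shift j) * (U ((fun y : Site 3 L => y.shift k)^[n] (x.shift k), j))⁻¹) := by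
      -- `(x + e_j) + e_k = (x + e_k) + e_j` (tree: `TwoLattice.Stiff.shift_shift_comm`; one line keeps that import out)
      have hsc : (x.shift j).shift k = (x.shift k).shift j := by simp only [Site.shift]; abel
      rw [lineHolonomy, hsc, ← mul_assoc (U (x, j)), transverse_step_dir_eq]
      simp only [mul_assoc]
    rw [hstep, lineHolonomy, add_comm]
    exact (norm_su2Quat_step_le _ _ _ _).trans (add_le_add le_rfl (ih (x.shift k)))

/-- The closed `k`-line returns to its base point. [folklore] -/
theorem iterate_shift_dir_self (k : Fin 3) (x : Site 3 L) : (fun y : Site 3 L => y.shift k)^[L] x = x := by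
  rw [iterate_shift_dir_eq, ZMod.natCast_self, Pi.single_zero, add_zero]

/-- **Closed transverse ladder in direction `k`**: `‖q(U(x,j) P(x+e_j) U(x,j)⁻¹) − q(P(x))‖ ≤ L ε` for the closed `k`-line `P = lineHolonomy U k L`.
[cite: Luscher1983, §2] -/
theorem norm_su2Quat_transportDir_closed_sub_le {U : GaugeConfig 3 L SU2} {ε : ℝ}
    (hP : ∀ (y : Site 3 L) (i j : Fin 3), ‖su2Quat (plaquetteHolonomy U y i j) - 1‖ ≤ ε) (k j : Fin 3) (x : Site 3 L) :
    ‖su2Quat (U (x, j) * lineHolonomy U k L (x.shift j) * (U (x, j))⁻¹) - su2Quat (lineHolonomy U k L x)‖ ≤ L * ε := by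
  have h := norm_su2Quat_transportDir_sub_le U k j L x
  rw [iterate_shift_dir_self] at h
  exact h.trans ((Finset.sum_le_card_nsmul _ _ _ fun m _ => hP _ _ _).trans (by simp))

/-- ★ **Column ladder**: carrying the closed `k`-line `m` steps along `e_j` by conjugation with the column holonomy `C = lineHolonomy U j m y` costs
`m L ε`: `‖q(C · P(y + m e_j) · C⁻¹) − q(P(y))‖ ≤ m L ε`. [cite: Luscher1983, §2] -/
theorem norm_su2Quat_column_conj_sub_le {U : GaugeConfig 3 L SU2} {ε : ℝ}
    (hP : ∀ (y : Site 3 L) (i j : Fin 3), ‖su2Quat (plaquetteHolonomy U y i j) - 1‖ ≤ ε) (k j : Fin 3) :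
    ∀ (m : ℕ) (y : Site 3 L),
      ‖su2Quat (lineHolonomy U j m y * lineHolonomy U k L (y + Pi.single j ((m : ℕ) : ZMod L)) * (lineHolonomy U j m y)⁻¹) -
          su2Quat (lineHolonomy U k L y)‖ ≤ m * (L * ε)
  | 0, y => by simp [lineHolonomy]
  | m + 1, y => by
    have ih := norm_su2Quat_column_conj_sub_le hP k j m (y.shift j)
    have hbase : y.shift j + Pi.single j ((m : ℕ) : ZMod L) = y + Pi.single j (((m + 1 : ℕ) : ℕ) : ZMod L) := WilsonLoopRP.shift_add_single y j m
    rw [← hbase, lineHolonomy]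
    set C := lineHolonomy U j m (y.shift j) with hC
    set P' := lineHolonomy U k L (y.shift j + Pi.single j ((m : ℕ) : ZMod L)) with hP'
    have hsplit : U (y, j) * C * P' * (U (y, j) * C)⁻¹ = U (y, j) * (C * P' * C⁻¹) * (U (y, j))⁻¹ := by group
    rw [hsplit]
    have h1 : ‖su2Quat (U (y, j) * (C * P' * C⁻¹) * (U (y, j))⁻¹) - su2Quat (U (y, j) * lineHolonomy U k L (y.shift j) * (U (y, j))⁻¹)‖ ≤ m * (L * ε) := by
      have hW := norm_su2Quat_conj_sub_conj' (U (y, j)) (C * P' * C⁻¹) (lineHolonomy U k L (y.shift j))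
      rw [hW]; exact ih
    have h2 := norm_su2Quat_transportDir_closed_sub_le hP k j y
    calc _ ≤ ‖su2Quat (U (y, j) * (C * P' * C⁻¹) * (U (y, j))⁻¹) - su2Quat (U (y, j) * lineHolonomy U k L (y.shift j) * (U (y, j))⁻¹)‖ +
          ‖su2Quat (U (y, j) * lineHolonomy U k L (y.shift j) * (U (y, j))⁻¹) - su2Quat (lineHolonomy U k L y)‖ := by
            rw [← sub_add_sub_cancel (su2Quat (U (y, j) * (C * P' * C⁻¹) * (U (y, j))⁻¹))
              (su2Quat (U (y, j) * lineHolonomy U k L (y.shift j) * (U (y, j))⁻¹)) (su2Quat (lineHolonomy U k L y))]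
            exact norm_add_le _ _
      _ ≤ m * (L * ε) + L * ε := add_le_add h1 h2
      _ = (m + 1 : ℕ) * (L * ε) := by push_cast; ring

/-! ## §2 Time ladders in direction `k` and the transport of the seam field -/

/-- **Time ladder in direction `k`**: `‖q(P^U_n(x)) − q(P^V_n(x))‖ ≤ Σ_{m<n} ‖q(U(x+me_k,k)) − q(V(x+me_k,k))‖`. [folklore] -/
theorem norm_su2Quat_lineHolonomyDir_sub_le (U V : GaugeConfig 3 L SU2) (k : Fin 3) (n : ℕ) :
    ∀ x : Site 3 L, ‖su2Quat (lineHolonomy U k n x) - su2Quat (lineHolonomy V k n x)‖ ≤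
      ∑ m ∈ Finset.range n, ‖su2Quat (U ((fun y : Site 3 L => y.shift k)^[m] x, k)) - su2Quat (V ((fun y : Site 3 L => y.shift k)^[m] x, k))‖ := by
  induction n with
  | zero => intro x; simp [lineHolonomy]
  | succ n ih =>
    intro x
    rw [Finset.sum_range_succ', Function.iterate_zero_apply]
    simp only [Function.iterate_succ_apply]
    rw [lineHolonomy, lineHolonomy, su2Quat_mul, su2Quat_mul]
    refine (norm_mul_sub_mul_le' _ _ _ _).trans ?_
    rw [norm_su2Quat, norm_su2Quat, mul_one, one_mul, add_comm]
    exact add_le_add (ih (x.shift k)) le_rfl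

/-- A uniform link bound sums to `n τ` along a line of `n` steps in direction `k`. [folklore] -/
theorem norm_su2Quat_lineHolonomyDir_sub_le_mul {U V : GaugeConfig 3 L SU2} {τ : ℝ} (hT : ∀ e : Edge 3 L, ‖su2Quat (U e) - su2Quat (V e)‖ ≤ τ)
    (k : Fin 3) (n : ℕ) (x : Site 3 L) :
    ‖su2Quat (lineHolonomy U k n x) - su2Quat (lineHolonomy V k n x)‖ ≤ n * τ :=
  (norm_su2Quat_lineHolonomyDir_sub_le U V k n x).trans ((Finset.sum_le_card_nsmul _ _ _ fun m _ => hT _).trans (by simp))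

/-- **One step of the seam-field transport**: if the gauge image `g · U` is linkwise `τ`-close to `U`, then
`‖q(g(y+e_k)) − q(U(y,k)⁻¹ g(y) U(y,k))‖ ≤ τ`. [folklore] -/
theorem norm_su2Quat_seamField_step_le {U : GaugeConfig 3 L SU2} {g : Site 3 L → SU2} {τ : ℝ}
    (hG : ∀ e : Edge 3 L, ‖su2Quat (gaugeTransform g U e) - su2Quat (U e)‖ ≤ τ) (y : Site 3 L) (k : Fin 3) :
    ‖su2Quat (g (y.shift k)) - su2Quat ((U (y, k))⁻¹ * g y * U (y, k))‖ ≤ τ := by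
  have h := hG (y, k)
  simp only [gaugeTransform] at h
  -- `U⁻¹ (g U g'⁻¹) g' = U⁻¹ g U`, so the difference is a two-sided unit multiple of `(g U g'⁻¹) − U`
  have hid : su2Quat (g (y.shift k)) - su2Quat ((U (y, k))⁻¹ * g y * U (y, k)) =
      -(su2Quat ((U (y, k))⁻¹) * (su2Quat (g y * U (y, k) * (g (y.shift k))⁻¹) - su2Quat (U (y, k))) * su2Quat (g (y.shift k))) := by
    rw [mul_sub, sub_mul]
    rw [← su2Quat_mul, ← su2Quat_mul, ← su2Quat_mul, ← su2Quat_mul]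
    have e1 : (U (y, k))⁻¹ * (g y * U (y, k) * (g (y.shift k))⁻¹) * g (y.shift k) = (U (y, k))⁻¹ * g y * U (y, k) := by group
    have e2 : (U (y, k))⁻¹ * U (y, k) * g (y.shift k) = g (y.shift k) := by group
    rw [e1, e2]; abel
  rw [hid, norm_neg, norm_mul, norm_mul, norm_su2Quat, norm_su2Quat, one_mul, mul_one]
  exact h

/-- ★ **Transport of the seam field along a line**: if `g · U` is linkwise `τ`-close to `U`, then for the line `P = lineHolonomy U k n y`,
`‖q(g(y + n e_k)) − q(P⁻¹ g(y) P)‖ ≤ n τ` (`g` is covariantly constant up to `n τ`; the endpoint written as an iterate of the shift). [cite: Luscher1983, §2] -/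
theorem norm_su2Quat_seamField_transport_sub_le {U : GaugeConfig 3 L SU2} {g : Site 3 L → SU2} {τ : ℝ}
    (hG : ∀ e : Edge 3 L, ‖su2Quat (gaugeTransform g U e) - su2Quat (U e)‖ ≤ τ) (k : Fin 3) (n : ℕ) :
    ∀ y : Site 3 L,
      ‖su2Quat (g ((fun z : Site 3 L => z.shift k)^[n] y)) - su2Quat ((lineHolonomy U k n y)⁻¹ * g y * lineHolonomy U k n y)‖ ≤ n * τ := by
  induction n with
  | zero =>
    intro y
    simp only [Function.iterate_zero_apply, Nat.cast_zero, lineHolonomy, inv_one, one_mul, mul_one, sub_self, norm_zero, zero_mul, le_refl]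
  | succ n ih0 =>
    intro y
    have ih := ih0 (y.shift k)
    rw [← Function.iterate_succ_apply] at ih
    have hrec : lineHolonomy U k (n + 1) y = U (y, k) * lineHolonomy U k n (y.shift k) := rfl
    rw [hrec]
    set P := lineHolonomy U k n (y.shift k) with hPdef
    set A := su2Quat (g ((fun z : Site 3 L => z.shift k)^[n + 1] y)) with hA
    have hsplit : (U (y, k) * P)⁻¹ * g y * (U (y, k) * P) = P⁻¹ * ((U (y, k))⁻¹ * g y * U (y, k)) * P := by group
    rw [hsplit]
    have h1 : ‖su2Quat (P⁻¹ * g (y.shift k) * P) - su2Quat (P⁻¹ * ((U (y, k))⁻¹ * g y * U (y, k)) * P)‖ ≤ τ := by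
      have hiso := norm_su2Quat_conj_sub_conj P (g (y.shift k)) ((U (y, k))⁻¹ * g y * U (y, k))
      rw [hiso]; exact norm_su2Quat_seamField_step_le hG y k
    have htri : ‖A - su2Quat (P⁻¹ * ((U (y, k))⁻¹ * g y * U (y, k)) * P)‖ ≤
        ‖A - su2Quat (P⁻¹ * g (y.shift k) * P)‖ + ‖su2Quat (P⁻¹ * g (y.shift k) * P) - su2Quat (P⁻¹ * ((U (y, k))⁻¹ * g y * U (y, k)) * P)‖ := by
      rw [← sub_add_sub_cancel A (su2Quat (P⁻¹ * g (y.shift k) * P)) (su2Quat (P⁻¹ * ((U (y, k))⁻¹ * g y * U (y, k)) * P))]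
      exact norm_add_le _ _
    have hsum : ‖A - su2Quat (P⁻¹ * g (y.shift k) * P)‖ + ‖su2Quat (P⁻¹ * g (y.shift k) * P) - su2Quat (P⁻¹ * ((U (y, k))⁻¹ * g y * U (y, k)) * P)‖ ≤
        n * τ + τ := add_le_add ih h1
    have hcast : ((n + 1 : ℕ) : ℝ) * τ = n * τ + τ := by push_cast; ring
    rw [hcast]
    exact htri.trans hsum

/-- **The seam field almost commutes with closed loops**: if `g · U` is linkwise `τ`-close to `U`, then for the closed `k`-line `P = lineHolonomy U k L y`,
`‖q_{g(y)} q_P − q_P q_{g(y)}‖ ≤ L τ` (the loop of `g · U` is `g(y) P g(y)⁻¹` and is `Lτ`-close to `P`). [cite: Luscher1983, §2] -/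
theorem norm_comm_seamField_loop_le {U : GaugeConfig 3 L SU2} {g : Site 3 L → SU2} {τ : ℝ}
    (hG : ∀ e : Edge 3 L, ‖su2Quat (gaugeTransform g U e) - su2Quat (U e)‖ ≤ τ) (k : Fin 3) (y : Site 3 L) :
    ‖su2Quat (g y) * su2Quat (lineHolonomy U k L y) - su2Quat (lineHolonomy U k L y) * su2Quat (g y)‖ ≤ L * τ := by
  have h1 := norm_su2Quat_lineHolonomyDir_sub_le_mul hG k L y
  rw [lineHolonomy_gaugeTransform_closed] at h1
  -- `‖q(gPg⁻¹) − q(P)‖ = ‖q_g q_P − q_P q_g‖`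
  have h2 : ‖su2Quat (g y * lineHolonomy U k L y * (g y)⁻¹) - su2Quat (lineHolonomy U k L y)‖ =
      ‖su2Quat (g y) * su2Quat (lineHolonomy U k L y) - su2Quat (lineHolonomy U k L y) * su2Quat (g y)‖ := by
    have hg : ‖su2Quat (g y)‖ = 1 := norm_su2Quat _
    have hg0 : su2Quat (g y) ≠ 0 := su2Quat_ne_zero _
    rw [su2Quat_mul, su2Quat_mul, su2Quat_inv]
    have e : su2Quat (g y) * su2Quat (lineHolonomy U k L y) * (su2Quat (g y))⁻¹ - su2Quat (lineHolonomy U k L y) =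
        (su2Quat (g y) * su2Quat (lineHolonomy U k L y) - su2Quat (lineHolonomy U k L y) * su2Quat (g y)) * (su2Quat (g y))⁻¹ := by
      rw [sub_mul, mul_assoc (su2Quat (lineHolonomy U k L y)), mul_inv_cancel₀ hg0, mul_one]
    rw [e, norm_mul, norm_inv, hg, inv_one, mul_one]
  rw [← h2]; exact h1

end Summit.QuantumFields.YangMills.Theorems.FemtoTransferGap.GAxis

end
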